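import Summits.BirchSwinnertonDyer.BirchSwinnertonDyer.Theorems.SemiOrdinaryEisensteinDescentShaTwoCochainShell
import Summits.BirchSwinnertonDyer.BirchSwinnertonDyer.Theorems.SemiOrdinaryEisensteinDescentShaTwoCochainBridgeSum
import Summits.BirchSwinnertonDyer.BirchSwinnertonDyer.Theorems.SemiOrdinaryEisensteinDescentShaTwoCochainClassReadout
import Summits.BirchSwinnertonDyer.BirchSwinnertonDyer.Theorems.SemiOrdinaryEisensteinDescentCasselsTateLevelInputsOfPoitouTateAt
import Summits.BirchSwinnertonDyer.BirchSwinnertonDyer.Theorems.GenusKolyvaginAtTwoCasselsTateLemma615AnyLevel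
import Literature.NumberTheory.GaloisRepresentations.ContinuousH2OrderTwo
import HarnessLib

/-!
# The Cassels–Tate pairing of THE canonical invariant maps is a LEVEL pairing at every ODD prime-power level, over EVERY
# number field and for EVERY elliptic curve — `hPTc` at odd level for any curve (not only base changes from `ℚ`)

Route `GenusKolyvaginAtTwo`, crux `KolyvaginExactAtTwo` (stmt-BirchSwinnertonDyer-22137) → Q3-inner, Cassels–Tate block;
seat `bsd-line-gk2-p2` g13 (cell `bsd-f1-sign2`), `--supports 22137`, helper. THEOREMS ONLY (no definition, no named fact, no
`sorry`, no instance).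

Cell `bsd-wall`'s closer `casselsTate_levelInputs K` (item stmt-BirchSwinnertonDyer-20191) is typed, like its named fact, for base
changes `E = W_ℚ ⊗ K` together with an involution of `K/ℚ` — over `K = ℚ` it says nothing, although its Ш²-cochain bridge
(`ShaTwoCochain.exists_bridge_sum_localInvariants_eq_zero`, w3 g7) is generic in the curve. This file records the generic odd-level
statements (the companions of this seat's `…CasselsTatePTcTotallyComplex`, which removes oddness over a totally complex field):

* §1 `readout_eq_zero_of_odd` — road B's readout vanishes on `Ш¹(K, E[m])`, `m = p^k` odd, ANY number field `K`, ANY `E/K`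
  (w4 g2's `hbridge_of_readout_criterion` without the base-change typing; archimedean classes vanish as `m²`-torsion `2`-torsion
  classes, `H³(K, μ_{m²}) = 0` by `cd_p Γ_K ≤ 2`);
* §2 **`hPTc_canonical_of_odd`** — Milne I 4.10 (a) for `Ш²(K, E[m])` in `PTChoice` cochain form for THE maps, odd `m = p^k`, any `K`,
  any `E/K`;
* §3 **`isLevelPairing_ctLevelPairing_canonical_of_odd`** — `ctLevelPairing` of THE maps on `Ш(E/K)[p^k]` is a LEVEL pairing for odd `p`,
  UNCONDITIONALLY, every number field (so `K = ℚ`), every `E/K` (`h615` = `CasselsTateAnyLevel.lemma615Input_canonical`, alternation =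
  `ctGeneralFun_self_eq_zero_of_odd`); `exists_isLevelPairing_of_odd` — the existence form, i.e. the hypothesis of the tree's
  `WeierstrassCurve.exists_casselsTate_pairing_of_levelwise` at every odd prime: over `ℚ`, route item 19420 `CasselsTatePairingRat`
  (`exists_casselsTate_pairing (K := ℚ)`) is thereby reduced to the `2`-power levels {`hPTc` at `2^k` over `ℚ`, Cassels' alternation}.

BSD is not proved by any of this.

References: [MilneADT2006] I Thm. 4.10 (a), Lemma 4.13, Rem. 3.7, §6 Prop. 6.9, Rem. 6.10–6.11, Thm. 6.13 (a), Lemma 6.15;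
[CasselsFrohlichANT1967] Ch. VII §11.2 (bis); [SerreGaloisCohomology1997] II §4.4 Prop. 13; [Cassels1962ArithmeticIV];
[SilvermanAEC2009] Thm. X.4.14.
-/

noncomputable section

open scoped Classical

-- the Theorems namespace of this sub repeats the summit name by design (D-0017 nested layout)
set_option linter.dupNamespace false
set_option autoImplicit false

namespace Summit.BirchSwinnertonDyer.BirchSwinnertonDyer.Theorems.GenusExact.CasselsTatePTc

open CategoryTheory _root_.WeierstrassCurve Field Function NumberField IsDedekindDomain
open Literature.NumberTheory.EllipticCurves
open Literature.NumberTheory.GaloisRepresentations Literature.NumberTheory.GaloisRepresentations.HomDual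
  Literature.NumberTheory.GaloisCohomology
open Literature.Algebra.Homology Literature.Algebra.Homology.DiscreteRep ContRepresentation Literature
open Literature.NumberTheory.GaloisRepresentations.DiscreteGaloisModule (units UnitsCarrier mu MuCarrier TateDual tateDual
  tateDualPairing pairingDualHom pairingDualIntertwining sha shaTwo)
open Literature.NumberTheory.GaloisRepresentations.IdeleClassBar (classBarD classBarInv)
open Literature.NumberTheory.GaloisRepresentations.FreePresentation
open Literature.NumberTheory.GaloisRepresentations.DGMBridge
open Literature.NumberTheory.GaloisRepresentations.OpenLayer (extOneEquiv)
open Literature.Algebra.Homology.ExtPresentation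
open Literature.AnabelianGeometry.AbsoluteAnabelian (Prop121vii.brauerInvariantEquiv Prop121vii.zmodToQmodZ)
open Summit.BirchSwinnertonDyer.BirchSwinnertonDyer.Theorems.ShaTwoCochain
open Summit.BirchSwinnertonDyer.BirchSwinnertonDyer.Theorems.ShaTwoCochainTheta
open Summit.BirchSwinnertonDyer.BirchSwinnertonDyer.Theorems.SchneiderFreeAdditiveX3.PoitouTateReduction (exists_bidual_intertwining)
open Summit.BirchSwinnertonDyer.BirchSwinnertonDyer.Theorems.CasselsTateLemma615OfPT (galoisCohomology_three_mu_eq_zero_of_ne_two)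
open scoped ContRepresentation NumberField

/-! ## §1 The readout vanishes on `Ш¹` at odd prime-power level, any number field, any curve -/

section Readout

variable {K : Type} [Field K] [NumberField K] {W : WeierstrassCurve K} {p k : ℕ} [Fact p.Prime] [NeZero (p ^ k)]
variable {e : geomTorsion W ((p ^ k * p ^ k : ℕ) : ℤ) → geomTorsion W ((p ^ k * p ^ k : ℕ) : ℤ) → AlgebraicClosure K}
  {hμ : ∀ S T, e S T ^ (p ^ k * p ^ k) = 1}
  {hadd₁ : ∀ S₁ S₂ T, e (S₁ + S₂) T = e S₁ T * e S₂ T}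
  {hadd₂ : ∀ S T₁ T₂, e S (T₁ + T₂) = e S T₁ * e S T₂}
  {hgal : ∀ (σ : absoluteGaloisGroup K) (S T : geomTorsion W ((p ^ k * p ^ k : ℕ) : ℤ)), σ • e S T = e (σ • S) (σ • T)}
variable [Finite (geomTorsion W ((p ^ k : ℕ) : ℤ))]

/-- `H³(K, μ_{p^k · p^k}) = 0` outright for an odd prime `p` (the tree's `galoisCohomology_three_mu_eq_zero_of_ne_two`, `cd_p Γ_K ≤ 2`).
[cite: SerreGaloisCohomology1997, II §4.4 Prop. 13] -/
theorem galoisCohomology_three_mu_sq_eq_zero_of_ne_two (K : Type) [Field K] [NumberField K] (p k : ℕ) [Fact p.Prime]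
    (hp2 : p ≠ 2) [NeZero (p ^ k * p ^ k)] : ∀ z : galoisCohomology (mu K (p ^ k * p ^ k)) 3, z = 0 := by
  haveI : NeZero (p ^ (k + k)) := ⟨pow_ne_zero _ (Fact.out : p.Prime).ne_zero⟩
  rw [← pow_add]
  exact fun z => galoisCohomology_three_mu_eq_zero_of_ne_two K p (k + k) hp2 z

/-- `Ш³(K, μ_{p^k · p^k}) = 0` for an odd prime `p`, in the displayed shape of the Cassels–Tate recipe.
[cite: SerreGaloisCohomology1997, II §4.4 Prop. 13][cite: MilneADT2006, Ch. I, Thm. 4.10 (c)] -/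
theorem shaThree_mu_eq_zero_of_ne_two (K : Type) [Field K] [NumberField K] (p k : ℕ) [Fact p.Prime] (hp2 : p ≠ 2)
    [NeZero (p ^ k * p ^ k)] :
    ∀ c : galoisCohomology (mu K (p ^ k * p ^ k)) 3,
      (∀ v : Place K, galoisCohomology.localization (mu K (p ^ k * p ^ k)) v 3 c = 0) → c = 0 :=
  fun c _ => galoisCohomology_three_mu_sq_eq_zero_of_ne_two K p k hp2 c

/-- **Road B's readout `classBarInv(Φ⁻¹[γ] ∘ ∂h)` vanishes for every `y = [γ] ∈ Ш¹(K, E[m])`**, `m = p^k` ODD, ANY number field `K`,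
ANY elliptic `E/K`: given `hPTc`'s hypothesis for `f` and `Ψ h = θ′_* [f]` — w4 g2's `hbridge_of_readout_criterion` proof on a general
curve (w3 g7's bridge sum is generic): archimedean classes of the bridge's idèle cocycle are `m²`-torsion and `2`-torsion, hence `0`.
[cite: MilneADT2006, Ch. I Thm. 4.10 (a) (proof, pp. 57–58), Lemma 4.13, Rem. 3.7][cite: CasselsFrohlichANT1967, Ch. VII §11.2 (bis)] -/
theorem readout_eq_zero_of_odd [NeZero (p ^ k * p ^ k)] (hp2 : p ≠ 2)
    {f : contTwoCocycles (W.torsionGaloisModule ((p ^ k : ℕ) : ℤ)).toTopRep}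
    (hf : ∀ g : contOneCocycles (W.torsionGaloisModule ((p ^ k : ℕ) : ℤ)).toTopRep,
      (∀ v : Place K, locClass (W.torsionGaloisModule ((p ^ k : ℕ) : ℤ)) (Place.Completion v)
          (resOne (W.torsionGaloisModule ((p ^ k : ℕ) : ℤ)) (Place.Completion v) g) = 0) →
      ∃ (C : PTChoice W (p ^ k) e hμ hadd₁ hadd₂ hgal f g) (S : Finset (Place K)),
        (∀ v ∉ S, C.localTerm (LocalInvariants.canonical K (p ^ k * p ^ k)) v = 0) ∧
          ∑ v ∈ S, C.localTerm (LocalInvariants.canonical K (p ^ k * p ^ k)) v = 0)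
    (h : (presentationComplex (W.torsionGaloisModule ((p ^ k : ℕ) : ℤ))).X₁ ⟶ classBarD K)
    (hh : shaTwoConnecting (W.torsionGaloisModule ((p ^ k : ℕ) : ℤ)) (p ^ k * p ^ k)
        (FirstCaseData.mul_nsmul_geomTorsion_eq_zero (W := W) (m := p ^ k)) h =
      galoisCohomology.map (pairingDualIntertwining
        (ρ₁ := W.torsionGaloisModule ((p ^ k : ℕ) : ℤ)) (ρ₂ := W.torsionGaloisModule ((p ^ k : ℕ) : ℤ))
        (B := (descendHom W (p ^ k) (p ^ k) e hμ hadd₁ hadd₂).flip)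
        (ShaTwoCochainTheta.descendHom_flip_smul W (p ^ k) e hμ hadd₁ hadd₂ hgal)) 2
        (twoCocycleClass _ f))
    (y : galoisCohomology (W.torsionGaloisModule ((p ^ k : ℕ) : ℤ)) 1) (hy : y ∈ sha (W.torsionGaloisModule ((p ^ k : ℕ) : ℤ))) :
    classBarInv K (((extOneEquiv (W.torsionGaloisModule ((p ^ k : ℕ) : ℤ))).symm y).comp
      (boundary (presentationComplex_shortExact (W.torsionGaloisModule ((p ^ k : ℕ) : ℤ))) (classBarD K) h) (rfl : 1 + 1 = 2)) = 0 := by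
  haveI := absoluteGaloisGroup_compactSpace K
  have hp : p.Prime := Fact.out
  have hm : Odd (p ^ k) := (hp.odd_of_ne_two hp2).pow
  have hodd : Odd (p ^ k * p ^ k) := hm.mul hm
  have hH3 : ∀ z : galoisCohomology (mu K (p ^ k * p ^ k)) 3, z = 0 :=
    galoisCohomology_three_mu_sq_eq_zero_of_ne_two K p k hp2
  -- a cocycle `γ ∈ y`, locally trivial
  obtain ⟨γ, rfl⟩ := oneCocycleClass_surjective _ y
  have hγ := (oneCocycleClass_mem_sha_iff_locClass (W.torsionGaloisModule ((p ^ k : ℕ) : ℤ)) γ).1 hy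
  -- the bridge sum package for THE idèle projections (w3 g7, generic in the curve)
  obtain ⟨c, ht, Z, S', h3, h4, h5, -, hb, hc⟩ :=
    exists_bridge_sum_localInvariants_eq_zero (hgal := hgal) hm hH3 hf h hh hγ fun v => IdeleReadout.ideleProjection K v
  -- the local projection cocycles at the finite places
  choose cZ hcZ using fun v : HeightOneSpectrum (𝓞 K) =>
    exists_localProjectionCocycle Z (Sum.inr v) (IdeleReadout.ideleProjection K (Sum.inr v))
  -- the archimedean classes vanish: `m²`-torsion with `m²` odd, and `2 · H²(K_w, ·) = 0`
  have hinf : ∀ (w : InfinitePlace K) (cW : contTwoCocycles (units (Place.Completion (Sum.inl w : Place K))).toTopRep),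
      (∀ s t : absoluteGaloisGroup (Place.Completion (Sum.inl w : Place K)),
        cW.1 (s, t) = ((IdeleReadout.ideleProjection K (Sum.inl w)).toAddMonoidHom.comp (LCarrier.val (ideleBarD K)))
          (Z.1 (absGaloisRestrict K (Place.Completion (Sum.inl w : Place K)) s,
            absGaloisRestrict K (Place.Completion (Sum.inl w : Place K)) t))) →
      (haveI := absoluteGaloisGroup_compactSpace (Place.Completion (Sum.inl w : Place K));
        twoCocycleClass (units (Place.Completion (Sum.inl w : Place K))).toTopRep cW) = 0 := fun w cW hcW =>
    eq_zero_of_odd_nsmul_eq_zero_two_infinitePlace w _ hodd _ (hc (Sum.inl w) cW hcW)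
  exact ShaTwoCochain.classBarInv_readout_eq_zero_of_criterion K (p ^ k * p ^ k) (W.torsionGaloisModule ((p ^ k : ℕ) : ℤ))
    (FirstCaseData.mul_nsmul_geomTorsion_eq_zero (W := W) (m := p ^ k)) h γ c ht Z h3 h4 h5 cZ hcZ hinf
    ⟨S'.toRight, fun T hT => hb T (fun v hv => hT (Finset.mem_toRight.2 hv)) cZ hcZ⟩

end Readout

/-! ## §2 `hPTc` for THE maps at odd prime-power level, any number field, any curve -/

section PTc

variable {K : Type} [Field K] [NumberField K] (W : WeierstrassCurve K) [W.IsElliptic] (p k : ℕ) [Fact p.Prime]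
  [NeZero (p ^ k)]
variable (e : geomTorsion W ((p ^ k * p ^ k : ℕ) : ℤ) → geomTorsion W ((p ^ k * p ^ k : ℕ) : ℤ) → AlgebraicClosure K)
  (hμ : ∀ S T, e S T ^ (p ^ k * p ^ k) = 1)
  (hadd₁ : ∀ S₁ S₂ T, e (S₁ + S₂) T = e S₁ T * e S₂ T)
  (hadd₂ : ∀ S T₁ T₂, e S (T₁ + T₂) = e S T₁ * e S T₂)
  (hgal : ∀ (σ : absoluteGaloisGroup K) (S T : geomTorsion W ((p ^ k * p ^ k : ℕ) : ℤ)), σ • e S T = e (σ • S) (σ • T))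
  (halt : ∀ T, e T T = 1) (hnd : ∀ T, (∀ S, e S T = 1) → T = 0)

include halt hnd in
/-- **Milne I Thm. 4.10 (a) for `Ш²(K, E[m])` in the `PTChoice` cochain form (`hPTc`) for THE canonical invariant maps at every ODD
prime-power level `m = p^k`, over EVERY number field `K`, for EVERY elliptic curve `E/K`**: the Shell's flipped exhaustion and
readout-vanishing composed with §1. [cite: MilneADT2006, Ch. I Thm. 4.10 (a) (proof, pp. 57–58), Lemma 4.13, §6 Thm. 6.13 (a)]
[cite: CasselsFrohlichANT1967, Ch. VII §11.2 (bis)] -/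
theorem hPTc_canonical_of_odd (hp2 : p ≠ 2)
    (f : contTwoCocycles (W.torsionGaloisModule ((p ^ k : ℕ) : ℤ)).toTopRep)
    (hf : ∀ g : contOneCocycles (W.torsionGaloisModule ((p ^ k : ℕ) : ℤ)).toTopRep,
      (∀ v : Place K, locClass (W.torsionGaloisModule ((p ^ k : ℕ) : ℤ)) (Place.Completion v)
          (resOne (W.torsionGaloisModule ((p ^ k : ℕ) : ℤ)) (Place.Completion v) g) = 0) →
      ∃ (C : PTChoice W (p ^ k) e hμ hadd₁ hadd₂ hgal f g) (S : Finset (Place K)),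
        (∀ v ∉ S, C.localTerm (LocalInvariants.canonical K (p ^ k * p ^ k)) v = 0) ∧
          ∑ v ∈ S, C.localTerm (LocalInvariants.canonical K (p ^ k * p ^ k)) v = 0) :
    twoCocycleClass _ f = 0 := by
  haveI : NeZero (p ^ k * p ^ k) := ⟨mul_ne_zero (NeZero.ne _) (NeZero.ne _)⟩
  haveI : Finite (geomTorsion W ((p ^ k : ℕ) : ℤ)) := finite_geomTorsion_of_neZero W (p ^ k)
  haveI : Finite (TateDual K (geomTorsion W ((p ^ k : ℕ) : ℤ)) (p ^ k * p ^ k)) := DiscreteGaloisModule.TateDual.finite K _ _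
  obtain ⟨C, -, -⟩ := hf 0 fun v => locClass_resOne_zero _ v
  obtain ⟨ι, κ, hι, hκι, hικ⟩ := exists_bidual_intertwining (n := p ^ k * p ^ k) (W.torsionGaloisModule ((p ^ k : ℕ) : ℤ))
    (FirstCaseData.mul_nsmul_geomTorsion_eq_zero (W := W) (m := p ^ k))
  exact C.twoCocycleClass_eq_zero_of_shaTwoConnecting_eq_zero_flip
    (FirstCaseData.mul_nsmul_geomTorsion_eq_zero (W := W) (m := p ^ k)) halt hnd
    fun h hh => shaTwoConnecting_eq_zero_of_forall_sha_classBarInv_extOneEquiv_symm_eq_zero _ _ ι κ hι hκι hικ h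
      fun y hy => readout_eq_zero_of_odd (hgal := hgal) hp2 hf h hh y hy

/-! ## §3 The Cassels–Tate pairing of THE maps is a level pairing at odd prime-power level: any number field, any curve -/

include hnd in
/-- **The level-`p^k` Cassels–Tate pairing `ctLevelPairing` of THE canonical invariant maps on `Ш(E/K)[p^k]` is a LEVEL pairing
(alternating, kernel `Ш[p^k] ∩ p^k Ш`) for every ODD prime `p`, `k ≥ 1`, EVERY number field `K` and EVERY elliptic `E/K` —
UNCONDITIONALLY**: the tree's `isLevelPairing_ctLevelPairing_of_inputs` with `hPT'` = `sumInvLocalizationEqZero_canonical_of_numberField`,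
`hH3` = `shaThree_mu_eq_zero_of_ne_two`, `hPTc` = §2, `h615` = `CasselsTateAnyLevel.lemma615Input_canonical` (S₀ = ∅), `hct_alt` =
`ctGeneralFun_self_eq_zero_of_odd`. [cite: MilneADT2006, Ch. I §6 Prop. 6.9, Rem. 6.10–6.11, Thm. 6.13 (a), Lemma 6.15][cite: Cassels1962ArithmeticIV] -/
theorem isLevelPairing_ctLevelPairing_canonical_of_odd [NeZero (p ^ k * p ^ k)] (hp2 : p ≠ 2) (hk : 0 < k) :
    Literature.GroupTheory.FiniteAbelian.IsLevelPairing (p ^ k)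
      (ctLevelPairing W (p ^ k) e hμ hadd₁ hadd₂ hgal (LocalInvariants.canonical K (p ^ k * p ^ k)) halt
        (sumInvLocalizationEqZero_canonical_of_numberField K (p ^ k * p ^ k))
        (shaThree_mu_eq_zero_of_ne_two K p k hp2)
        (localTerm_finite_support W (p ^ k) e hμ hadd₁ hadd₂ hgal halt (LocalInvariants.canonical K (p ^ k * p ^ k)))) := by
  haveI : Finite (geomTorsion W ((p ^ k : ℕ) : ℤ)) := finite_geomTorsion_of_neZero W (p ^ k)
  have hodd : Odd (p ^ k) := ((Fact.out : p.Prime).odd_of_ne_two hp2).pow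
  exact isLevelPairing_ctLevelPairing_of_inputs W (p ^ k) e hμ hadd₁ hadd₂ hgal
    (LocalInvariants.canonical K (p ^ k * p ^ k)) halt (sumInvLocalizationEqZero_canonical_of_numberField K (p ^ k * p ^ k))
    (shaThree_mu_eq_zero_of_ne_two K p k hp2)
    (fun f hf => hPTc_canonical_of_odd W p k e hμ hadd₁ hadd₂ hgal halt hnd hp2 f hf) ∅
    (fun S _ x hx => CasselsTateAnyLevel.lemma615Input_canonical W p k e hμ hadd₁ hadd₂ hgal halt hnd hk S x hx)
    fun _ ha hma => ctGeneralFun_self_eq_zero_of_odd (LocalInvariants.canonical K (p ^ k * p ^ k)) halt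
      (sumInvLocalizationEqZero_canonical_of_numberField K (p ^ k * p ^ k)) (shaThree_mu_eq_zero_of_ne_two K p k hp2)
      (localTerm_finite_support W (p ^ k) e hμ hadd₁ hadd₂ hgal halt _) hodd ha hma

include hμ hadd₁ hadd₂ hgal halt hnd in
/-- **Existence form**: at every odd prime power a level pairing on `Ш(E/K)[p^k]` exists — every number field, every curve (the
hypothesis of the tree's `WeierstrassCurve.exists_casselsTate_pairing_of_levelwise` at the odd primes; e.g. route item 19420
`CasselsTatePairingRat` is thereby the `2`-power levels only). [cite: MilneADT2006, Ch. I §6, Thm. 6.13 (a)][cite: SilvermanAEC2009, Thm. X.4.14] -/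
theorem exists_isLevelPairing_of_odd [NeZero (p ^ k * p ^ k)] (hp2 : p ≠ 2) (hk : 0 < k) :
    ∃ B : AddSubgroup.torsionBy W.sha (p ^ k) →+ AddSubgroup.torsionBy W.sha (p ^ k) →+ AddCircle (1 : ℚ),
      Literature.GroupTheory.FiniteAbelian.IsLevelPairing (p ^ k) B :=
  ⟨_, isLevelPairing_ctLevelPairing_canonical_of_odd W p k e hμ hadd₁ hadd₂ hgal halt hnd hp2 hk⟩

end PTc

end Summit.BirchSwinnertonDyer.BirchSwinnertonDyer.Theorems.GenusExact.CasselsTatePTc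

end
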